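import Literature.Analysis.FluidPDE.PassiveVectorTensorPropagatorSteadyTest
import HarnessLib

/-!
# The passive-vector propagator tested against a steady smooth solenoidal field: the du Bois-Reymond IDENTITY
# (both generator integrands exposed)

Analysis/FluidPDE proof-support file (theorems only; no definitions, no named facts).  Companion of
`PassiveVectorTensorPropagatorSteadyTest` (which proves the BOUND `|⟪U s t y, G⟫ − ⟪y, G⟫| ≤ (t − s)·N·‖y‖`).  Here the
underlying identity is exposed at the propagator level, for the solution propagator `Torus.IsPropagator T b 𝔹 U`
(constant tensor `NearIso 𝔹 lo hi`, `0 < lo`, bounded a.e. divergence-free carrier `b`) and a smooth divergence-free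
steady test `G`:

* `IsPropagator.inner_eq_inner_add_setIntegral_of_steadyTest` — for `0 ≤ s ≤ t ≤ T` and EVERY `y ∈ L²`,

    `⟪U s t y, G⟫ = ⟪y, G⟫ + ∫_{τ ∈ (s,t]} ∫_{T^d} ⟪(U s τ y)(x), (b(τ,x)·∇)G(x) + (𝓛_𝔹^* G)(x)⟫ dx dτ`

  (du Bois-Reymond form of the weak formulation, `IsWeakTensorPassiveVectorOn.ae_integral_inner_eq`, on ONE weak solution
  from the Leray projection of `y`, which `U` represents (`IsPropagator.repr`); a.e. `t` ⟹ every `t` because both sides are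
  continuous in `t` — the left by the weak continuity of `U`, the right as the primitive of an integrable function —; the
  endpoint `t = T` through the propagator on a longer horizon, which restricts to `U` by uniqueness);
* `IsPropagator.integrableOn_inner_convect_steadyTest` / `IsPropagator.integrableOn_inner_viscAdj_steadyTest` — the TRANSPORT
  integrand `τ ↦ ∫⟪U s τ y, (b(τ)·∇)G⟫` and the DIFFUSION integrand `τ ↦ ∫⟪U s τ y, 𝓛_𝔹^*G⟫` are separately integrable on
  `(s, t]`, so that
* `IsPropagator.inner_eq_inner_add_setIntegral_add_setIntegral_of_steadyTest` — **the identity with the two integrands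
  SEPARATED**: `⟪U s t y, G⟫ = ⟪y, G⟫ + ∫_{(s,t]} ∫⟪U s τ y, (b(τ)·∇)G⟫ + ∫_{(s,t]} ∫⟪U s τ y, 𝓛_𝔹^*G⟫`.

The (ℓ2) block provers of K1L_D (stmt-AnomalousDissipation-27980; certifier table
`Cruxes/LagrangianRenormalisationStep/Lines/onelevel-ss-regimes.md` §2/§4) weigh the two integrands differently (transport:
`‖b‖_∞‖∇G‖₂‖y‖`; diffusion: modewise) — this file is the requested form with both exposed (ad-k3l-bookkeeping-p1 g9, 08:49Z).
[cite: DiPernaLions1989, §II.1 (12)–(14)] [cite: Temam1984, Ch. III §1 Lemma 1.2, Lemma 1.4] [cite: Pazy1983, Ch. 5 §5.1 Def. 5.3]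

## Mathlib / tree search
Tree: `PassiveVectorTensorPropagatorSteadyTest` (the bound; proof pattern reused), `PassiveVectorTensorClass`
(`IsWeakTensorPassiveVectorOn.ae_integral_inner_eq`, `integrable_inner_convect`, `integrable_inner_of_continuous`),
`PassiveVectorTensorPropagator` (`IsPropagator`, `exists_isPropagator`, `windowSol_spec`, `divFreeL2`), `…PropagatorUnique`
(`apply_eq_apply_starProjection`, `eq_of_isPropagator`), `…PropagatorLossMonotone` (`IsPropagator.of_horizon_le`).
Mathlib: `Measure.eqOn_Icc_of_ae_eq`, `intervalIntegral.continuousOn_primitive_interval`, `intervalIntegral.integral_comp_add_left`,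
`intervalIntegral.integral_of_le`, `Integrable.integral_prod_left`, `L2.inner_def`, `Lp.toLp_coeFn`.
-/

open MeasureTheory Set Filter Topology UnitAddTorus Function
open scoped ENNReal NNReal InnerProductSpace

noncomputable section

namespace Literature.Analysis.FluidPDE

namespace Torus

open FunctionSpaces.Torus FunctionSpaces

variable {d : Type*} [Fintype d] [DecidableEq d] [Nonempty d]
variable {T : ℝ} {𝔹 : Visc4 d} {lo hi : ℝ} {b : ℝ → UnitAddTorus d → EuclideanSpace ℝ d}
  {U : ℝ → ℝ → (Lp (EuclideanSpace ℝ d) 2 (volume : Measure (UnitAddTorus d)) →L[ℝ]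
    Lp (EuclideanSpace ℝ d) 2 (volume : Measure (UnitAddTorus d)))}

omit [DecidableEq d] [Nonempty d] in
/-- The `L²` pairing of two `L²` representatives is the inner product of their classes. [folklore] -/
private theorem integral_inner_eq_inner_toLp' {f g : UnitAddTorus d → EuclideanSpace ℝ d} (hf : MemLp f 2 volume) (hg : MemLp g 2 volume) :
    ∫ x, ⟪f x, g x⟫_ℝ = ⟪hf.toLp f, hg.toLp g⟫_ℝ := by
  rw [L2.inner_def]
  exact integral_congr_ae (by
    filter_upwards [hf.coeFn_toLp, hg.coeFn_toLp] with x hx hy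
    rw [hx, hy])

omit [DecidableEq d] [Nonempty d] in
/-- The `L²` pairing of an `L²` class (as an a.e. representative) with a representative is the inner product of the classes. [folklore] -/
private theorem integral_inner_coe_eq_inner_toLp (z : Lp (EuclideanSpace ℝ d) 2 (volume : Measure (UnitAddTorus d)))
    {g : UnitAddTorus d → EuclideanSpace ℝ d} (hg : MemLp g 2 volume) :
    ∫ x, ⟪(z : UnitAddTorus d → EuclideanSpace ℝ d) x, g x⟫_ℝ = ⟪z, hg.toLp g⟫_ℝ := by
  rw [L2.inner_def]
  exact integral_congr_ae (by
    filter_upwards [hg.coeFn_toLp] with x hy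
    rw [hy])

omit [Nonempty d] in
/-- MASTER LEMMA, open horizon (`s < T`): integrability on `(s, T)` of the transport integrand `gC`, the diffusion integrand `gL`
and the full generator integrand `g` (all as functions of absolute time, built from the a.e. representative of the class
`U s τ y`), the a.e. splitting `g = gC + gL`, and the du Bois-Reymond identity `⟪U s t y, G⟫ = ⟪y, G⟫ + ∫_{(s,t]} g` for every
`t ∈ [s, T)`. [cite: DiPernaLions1989, §II.1 (12)–(14)] [cite: Temam1984, Ch. III §1 Lemma 1.4] -/
private theorem IsPropagator.steadyTest_master_of_lt (hU : IsPropagator T b 𝔹 U) (h𝔹 : NearIso 𝔹 lo hi)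
    (hlo : 0 < lo) (hb : MemLp (stLift b) ∞ (volume.restrict (Ioo 0 T ×ˢ univ)))
    (hbdiv : ∀ᵐ τ ∂(volume.restrict (Ioo 0 T)), FunctionSpaces.Torus.IsWeaklyDivFree (b τ))
    {G : UnitAddTorus d → EuclideanSpace ℝ d} (hG : FunctionSpaces.Torus.IsSmooth G) (hGdiv : FunctionSpaces.Torus.IsDivFree G)
    {s : ℝ} (hs : 0 ≤ s) (hsT : s < T) (y : Lp (EuclideanSpace ℝ d) 2 (volume : Measure (UnitAddTorus d))) :
    IntegrableOn (fun τ => ∫ x, ⟪((U s τ y : Lp (EuclideanSpace ℝ d) 2 volume) : UnitAddTorus d → EuclideanSpace ℝ d) x,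
        FunctionSpaces.Torus.convect (b τ) G x + viscAdj 𝔹 G x⟫_ℝ) (Ioo s T) volume ∧
    IntegrableOn (fun τ => ∫ x, ⟪((U s τ y : Lp (EuclideanSpace ℝ d) 2 volume) : UnitAddTorus d → EuclideanSpace ℝ d) x,
        FunctionSpaces.Torus.convect (b τ) G x⟫_ℝ) (Ioo s T) volume ∧
    IntegrableOn (fun τ => ∫ x, ⟪((U s τ y : Lp (EuclideanSpace ℝ d) 2 volume) : UnitAddTorus d → EuclideanSpace ℝ d) x,
        viscAdj 𝔹 G x⟫_ℝ) (Ioo s T) volume ∧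
    (∀ᵐ τ ∂(volume.restrict (Ioo s T)),
      (∫ x, ⟪((U s τ y : Lp (EuclideanSpace ℝ d) 2 volume) : UnitAddTorus d → EuclideanSpace ℝ d) x,
          FunctionSpaces.Torus.convect (b τ) G x + viscAdj 𝔹 G x⟫_ℝ) =
        (∫ x, ⟪((U s τ y : Lp (EuclideanSpace ℝ d) 2 volume) : UnitAddTorus d → EuclideanSpace ℝ d) x,
            FunctionSpaces.Torus.convect (b τ) G x⟫_ℝ) +
          ∫ x, ⟪((U s τ y : Lp (EuclideanSpace ℝ d) 2 volume) : UnitAddTorus d → EuclideanSpace ℝ d) x, viscAdj 𝔹 G x⟫_ℝ) ∧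
    ∀ t, s ≤ t → t < T →
      ⟪U s t y, (hG.memLp 2).toLp G⟫_ℝ = ⟪y, (hG.memLp 2).toLp G⟫_ℝ +
        ∫ τ in Ioc s t, ∫ x, ⟪((U s τ y : Lp (EuclideanSpace ℝ d) 2 volume) : UnitAddTorus d → EuclideanSpace ℝ d) x,
          FunctionSpaces.Torus.convect (b τ) G x + viscAdj 𝔹 G x⟫_ℝ := by
  set G' : Lp (EuclideanSpace ℝ d) 2 (volume : Measure (UnitAddTorus d)) := (hG.memLp 2).toLp G with hG'def
  -- the generator applied to the test, as a function of absolute time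
  set g : ℝ → ℝ := fun τ => ∫ x, ⟪((U s τ y : Lp (EuclideanSpace ℝ d) 2 volume) : UnitAddTorus d → EuclideanSpace ℝ d) x,
        FunctionSpaces.Torus.convect (b τ) G x + viscAdj 𝔹 G x⟫_ℝ with hgdef
  set gC : ℝ → ℝ := fun τ => ∫ x, ⟪((U s τ y : Lp (EuclideanSpace ℝ d) 2 volume) : UnitAddTorus d → EuclideanSpace ℝ d) x,
        FunctionSpaces.Torus.convect (b τ) G x⟫_ℝ with hgCdef
  set gL : ℝ → ℝ := fun τ => ∫ x, ⟪((U s τ y : Lp (EuclideanSpace ℝ d) 2 volume) : UnitAddTorus d → EuclideanSpace ℝ d) x,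
        viscAdj 𝔹 G x⟫_ℝ with hgLdef
  -- the test class is divergence free, so only the Leray projection of `y` is seen on both sides
  have hGw : FunctionSpaces.Torus.IsWeaklyDivFree G := hGdiv.isWeaklyDivFree_holds hG
  have hG'mem : G' ∈ divFreeL2 d := (mem_divFreeL2_iff _).2 (hGw.congr_ae (MemLp.coeFn_toLp _).symm)
  set P := (divFreeL2 d).starProjection with hPdef
  set y' := P y with hy'def
  have hy' : FunctionSpaces.Torus.IsWeaklyDivFree ((y' : Lp (EuclideanSpace ℝ d) 2 volume) : UnitAddTorus d → EuclideanSpace ℝ d) :=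
    isWeaklyDivFree_starProjection y
  have hUy : ∀ τ, U s τ y = U s τ y' := fun τ => hU.apply_eq_apply_starProjection s τ y
  have hyG : ⟪y, G'⟫_ℝ = ⟪y', G'⟫_ℝ := by
    have h0 : ⟪y - y', G'⟫_ℝ = 0 := (divFreeL2 d).starProjection_inner_eq_zero y G' hG'mem
    rw [inner_sub_left] at h0
    linarith
  -- ONE weak solution from `y'` on `[s, T)`, represented by `U`
  set φ : UnitAddTorus d → EuclideanSpace ℝ d := (y' : UnitAddTorus d → EuclideanSpace ℝ d) with hφdef
  have hφ : MemLp φ 2 volume := Lp.memLp y'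
  have hyφ : hφ.toLp φ = y' := Lp.toLp_coeFn y' hφ
  set w := windowSol h𝔹 hlo hb hbdiv hs hsT hφ hy' with hwdef
  have hw : IsWeakTensorPassiveVectorOn 0 (T - s) 𝔹 (fun τ => b (s + τ)) φ w := windowSol_spec h𝔹 hlo hb hbdiv hs hsT hφ hy'
  have hrep := hU.repr s hs hsT φ hφ hy' w hw
  -- the integrand of the weak identity (window time `σ`), and its integrability on `(0, T − s)`
  set Φ : ℝ → ℝ := fun σ => ∫ x, ⟪w σ x, FunctionSpaces.Torus.convect (b (s + σ)) G x + viscAdj 𝔹 G x⟫_ℝ with hΦdef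
  have hG1 : FunctionSpaces.Torus.IsContDiff 1 G := hG.isContDiff (by simp)
  have hGd : ∀ j, Continuous (uncurry fun (_ : ℝ) (x : UnitAddTorus d) => FunctionSpaces.Torus.partialDeriv j G x) :=
    fun j => (hG.partialDeriv j).continuous.comp continuous_snd
  have hGl : Continuous (uncurry fun (_ : ℝ) (x : UnitAddTorus d) => viscAdj 𝔹 G x) :=
    (isSmooth_viscAdj 𝔹 hG).continuous.comp continuous_snd
  have hIc : Integrable (fun p : ℝ × UnitAddTorus d => ⟪w p.1 p.2, FunctionSpaces.Torus.convect (b (s + p.1)) G p.2⟫_ℝ)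
      (((volume : Measure ℝ).restrict (Ioo 0 (T - s))).prod volume) :=
    hw.integrable_inner_convect (Φ := fun _ => G) (fun _ => hG1) hGd
  have hIv : Integrable (fun p : ℝ × UnitAddTorus d => ⟪w p.1 p.2, viscAdj 𝔹 G p.2⟫_ℝ)
      (((volume : Measure ℝ).restrict (Ioo 0 (T - s))).prod volume) :=
    hw.integrable_inner_of_continuous (Φ := fun _ x => viscAdj 𝔹 G x) hGl
  have hI : Integrable (fun p : ℝ × UnitAddTorus d => ⟪w p.1 p.2, FunctionSpaces.Torus.convect (b (s + p.1)) G p.2 + viscAdj 𝔹 G p.2⟫_ℝ)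
      (((volume : Measure ℝ).restrict (Ioo 0 (T - s))).prod volume) := by
    refine (hIc.add hIv).congr (Eventually.of_forall fun p => ?_)
    simp only [Pi.add_apply, inner_add_right]
  have hΦint : IntegrableOn Φ (Ioo 0 (T - s)) volume := hI.integral_prod_left
  set ΦC : ℝ → ℝ := fun σ => ∫ x, ⟪w σ x, FunctionSpaces.Torus.convect (b (s + σ)) G x⟫_ℝ with hΦCdef
  set ΦL : ℝ → ℝ := fun σ => ∫ x, ⟪w σ x, viscAdj 𝔹 G x⟫_ℝ with hΦLdef
  have hΦCint : IntegrableOn ΦC (Ioo 0 (T - s)) volume := hIc.integral_prod_left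
  have hΦLint : IntegrableOn ΦL (Ioo 0 (T - s)) volume := hIv.integral_prod_left
  -- a.e. in window time the representative IS `U s (s+σ) y = U s (s+σ) y'` as an `L²` class: `Φ σ = g (s + σ)` etc.
  have hcoe : ∀ᵐ σ ∂(volume.restrict (Ioo 0 (T - s))),
      (w σ : UnitAddTorus d → EuclideanSpace ℝ d) =ᵐ[volume]
        ((U s (s + σ) y : Lp (EuclideanSpace ℝ d) 2 volume) : UnitAddTorus d → EuclideanSpace ℝ d) := by
    filter_upwards [hrep] with σ hσ
    obtain ⟨hm, he⟩ := hσ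
    rw [hUy (s + σ), ← hyφ, ← he]
    exact hm.coeFn_toLp.symm
  have hΦg : ∀ᵐ σ ∂(volume.restrict (Ioo 0 (T - s))), Φ σ = g (s + σ) := by
    filter_upwards [hcoe] with σ hσ
    exact integral_congr_ae (by filter_upwards [hσ] with x hx; rw [hx])
  have hΦCg : ∀ᵐ σ ∂(volume.restrict (Ioo 0 (T - s))), ΦC σ = gC (s + σ) := by
    filter_upwards [hcoe] with σ hσ
    exact integral_congr_ae (by filter_upwards [hσ] with x hx; rw [hx])
  have hΦLg : ∀ᵐ σ ∂(volume.restrict (Ioo 0 (T - s))), ΦL σ = gL (s + σ) := by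
    filter_upwards [hcoe] with σ hσ
    exact integral_congr_ae (by filter_upwards [hσ] with x hx; rw [hx])
  -- a.e. in window time the generator integrand splits
  have hΦsplit : ∀ᵐ σ ∂(volume.restrict (Ioo 0 (T - s))), Φ σ = ΦC σ + ΦL σ := by
    filter_upwards [hIc.prod_right_ae, hIv.prod_right_ae] with σ h1 h2
    rw [hΦdef, hΦCdef, hΦLdef]
    simp only
    rw [← integral_add h1 h2]
    refine integral_congr_ae (Eventually.of_forall fun x => ?_)
    simp only [inner_add_right]
  -- translation `σ ↦ s + σ` from window time `(0, T − s)` to absolute time `(s, T)`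
  have htrans : ∀ {F : ℝ → ℝ} {ΦF : ℝ → ℝ}, IntegrableOn ΦF (Ioo 0 (T - s)) volume →
      (∀ᵐ σ ∂(volume.restrict (Ioo 0 (T - s))), ΦF σ = F (s + σ)) → IntegrableOn F (Ioo s T) volume := by
    intro F ΦF hint hae
    have h1 : IntegrableOn (fun σ => F (s + σ)) (Ioo 0 (T - s)) volume := hint.congr_fun_ae hae
    have key := (measurePreserving_add_left (volume : Measure ℝ) s).integrableOn_comp_preimage
      (measurableEmbedding_addLeft s) (f := F) (s := Ioo s T)
    rw [Set.preimage_const_add_Ioo, sub_self] at key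
    exact key.1 h1
  have hgint : IntegrableOn g (Ioo s T) volume := htrans hΦint hΦg
  have hgCint : IntegrableOn gC (Ioo s T) volume := htrans hΦCint hΦCg
  have hgLint : IntegrableOn gL (Ioo s T) volume := htrans hΦLint hΦLg
  have hsplit : ∀ᵐ τ ∂(volume.restrict (Ioo s T)), g τ = gC τ + gL τ := by
    have h1 : ∀ᵐ σ ∂(volume.restrict (Ioo 0 (T - s))), g (s + σ) = gC (s + σ) + gL (s + σ) := by
      filter_upwards [hΦsplit, hΦg, hΦCg, hΦLg] with σ h h' hC hL
      rw [← h', ← hC, ← hL, h]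
    have hmp := (measurePreserving_add_left (volume : Measure ℝ) s).restrict_preimage_emb
      (measurableEmbedding_addLeft s) (Ioo s T)
    rw [Set.preimage_const_add_Ioo, sub_self] at hmp
    rw [← hmp.map_eq, (measurableEmbedding_addLeft s).ae_map_iff]
    exact h1
  refine ⟨hgint, hgCint, hgLint, hsplit, fun t hst htT => ?_⟩
  -- the case `t = s`
  rcases hst.eq_or_lt with heq | hst'
  · subst heq
    rw [Ioc_self, Measure.restrict_empty, integral_zero_measure, add_zero, hUy, hyG,
      hU.self_of_divFree s hs hsT.le y' hy']
  -- the weak identity: a.e. window time `τ`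
  have hid := hw.ae_integral_inner_eq hG hGdiv
  have hae : ∀ᵐ τ ∂(volume.restrict (Ioo 0 (T - s))),
      ⟪U s (s + τ) y', G'⟫_ℝ = ⟪y', G'⟫_ℝ + ∫ σ in Ioc 0 τ, Φ σ := by
    filter_upwards [hrep, hid, ae_restrict_mem measurableSet_Ioo] with τ hτr hτi hτm
    obtain ⟨hm, he⟩ := hτr
    have e1 : ⟪U s (s + τ) y', G'⟫_ℝ = ∫ x, ⟪w τ x, G x⟫_ℝ := by
      rw [hG'def, integral_inner_eq_inner_toLp' hm (hG.memLp 2), he, hyφ]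
    have e2 : ⟪y', G'⟫_ℝ = ∫ x, ⟪φ x, G x⟫_ℝ := by
      rw [hG'def, integral_inner_eq_inner_toLp' hφ (hG.memLp 2), hyφ]
    rw [e1, e2, hτi]
    congr 1
    refine integral_congr_ae (Eventually.of_forall fun σ => ?_)
    simp only [hΦdef, zero_mul, add_zero]
  -- every window time `τ ∈ [0, θ₁]`, `θ₁ < T − s`, by continuity of both sides
  set θ : ℝ := t - s with hθdef
  have hθ0 : 0 < θ := by rw [hθdef]; linarith
  have hθT : θ < T - s := by rw [hθdef]; linarith
  set θ₁ : ℝ := (θ + (T - s)) / 2 with hθ₁def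
  have hθθ₁ : θ < θ₁ := by rw [hθ₁def]; linarith
  have hθ₁T : θ₁ < T - s := by rw [hθ₁def]; linarith
  have hθ₁0 : 0 < θ₁ := hθ0.trans hθθ₁
  have hf : ContinuousOn (fun τ => ⟪U s (s + τ) y', G'⟫_ℝ) (Icc 0 θ₁) := by
    have hc := hU.continuousOn s hs hsT.le y' G'
    exact hc.comp (continuous_const.add continuous_id).continuousOn fun τ hτ => ⟨by linarith [hτ.1], by linarith [hτ.2]⟩
  have hΦint₁ : IntegrableOn Φ (Icc 0 θ₁) volume := by
    rw [integrableOn_Icc_iff_integrableOn_Ioo]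
    exact hΦint.mono_set (Ioo_subset_Ioo le_rfl hθ₁T.le)
  have hF : ContinuousOn (fun τ => ⟪y', G'⟫_ℝ + ∫ σ in Ioc 0 τ, Φ σ) (Icc 0 θ₁) := by
    have hprim : ContinuousOn (fun τ => ∫ σ in (0:ℝ)..τ, Φ σ) (Icc 0 θ₁) := by
      have h0 := intervalIntegral.continuousOn_primitive_interval (μ := volume) (f := Φ) (a := 0) (b := θ₁)
        (by rwa [uIcc_of_le hθ₁0.le])
      rwa [uIcc_of_le hθ₁0.le] at h0
    have h2 : ContinuousOn (fun τ => ⟪y', G'⟫_ℝ + ∫ σ in (0:ℝ)..τ, Φ σ) (Icc 0 θ₁) := continuousOn_const.add hprim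
    refine h2.congr fun τ hτ => ?_
    simp only [intervalIntegral.integral_of_le hτ.1]
  have haeIcc : (fun τ => ⟪U s (s + τ) y', G'⟫_ℝ) =ᵐ[volume.restrict (Icc 0 θ₁)]
      (fun τ => ⟪y', G'⟫_ℝ + ∫ σ in Ioc 0 τ, Φ σ) := by
    rw [← Measure.restrict_congr_set Ioo_ae_eq_Icc]
    exact ae_restrict_of_ae_restrict_of_subset (Ioo_subset_Ioo le_rfl hθ₁T.le) hae
  have heqOn := Measure.eqOn_Icc_of_ae_eq (volume : Measure ℝ) hθ₁0.ne haeIcc hf hF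
  have key : ⟪U s (s + θ) y', G'⟫_ℝ = ⟪y', G'⟫_ℝ + ∫ σ in Ioc 0 θ, Φ σ := heqOn ⟨hθ0.le, hθθ₁.le⟩
  -- back to absolute time: `∫_{(0,θ]} Φ = ∫_{(s,t]} g`
  have hΦg' : ∀ᵐ σ ∂(volume.restrict (Ioc 0 θ)), Φ σ = g (s + σ) := by
    rw [← Measure.restrict_congr_set Ioo_ae_eq_Ioc]
    exact ae_restrict_of_ae_restrict_of_subset (Ioo_subset_Ioo le_rfl hθT.le) hΦg
  have e3 : ∫ σ in Ioc 0 θ, Φ σ = ∫ τ in Ioc s t, g τ := by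
    rw [integral_congr_ae hΦg', ← intervalIntegral.integral_of_le hθ0.le,
      intervalIntegral.integral_comp_add_left (fun τ => g τ) s, ← intervalIntegral.integral_of_le (by linarith)]
    congr 1
    · rw [add_zero]
    · rw [hθdef]; ring
  have est : s + θ = t := by rw [hθdef]; ring
  rw [est] at key
  rw [hUy t, hyG, key, e3]

/-- MASTER LEMMA, closed horizon (`t ≤ T`, carrier data on a longer horizon `(0, T₁)`): the five facts of
`steadyTest_master_of_lt` for the propagator of horizon `T₁`, which restricts to `U` on `[s, T]` by uniqueness.
[cite: DiPernaLions1989, §II.1 (12)–(14)] [cite: Pazy1983, Ch. 5 §5.1 Def. 5.3] -/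
private theorem IsPropagator.steadyTest_master (hU : IsPropagator T b 𝔹 U) (h𝔹 : NearIso 𝔹 lo hi) (hlo : 0 < lo)
    {T₁ : ℝ} (hT₁ : T < T₁) (hb : MemLp (stLift b) ∞ (volume.restrict (Ioo 0 T₁ ×ˢ univ)))
    (hbdiv : ∀ᵐ τ ∂(volume.restrict (Ioo 0 T₁)), FunctionSpaces.Torus.IsWeaklyDivFree (b τ))
    {G : UnitAddTorus d → EuclideanSpace ℝ d} (hG : FunctionSpaces.Torus.IsSmooth G) (hGdiv : FunctionSpaces.Torus.IsDivFree G)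
    {s : ℝ} (hs : 0 ≤ s) (hsT : s ≤ T) (y : Lp (EuclideanSpace ℝ d) 2 (volume : Measure (UnitAddTorus d))) :
    IntegrableOn (fun τ => ∫ x, ⟪((U s τ y : Lp (EuclideanSpace ℝ d) 2 volume) : UnitAddTorus d → EuclideanSpace ℝ d) x,
        FunctionSpaces.Torus.convect (b τ) G x + viscAdj 𝔹 G x⟫_ℝ) (Ioo s T) volume ∧
    IntegrableOn (fun τ => ∫ x, ⟪((U s τ y : Lp (EuclideanSpace ℝ d) 2 volume) : UnitAddTorus d → EuclideanSpace ℝ d) x,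
        FunctionSpaces.Torus.convect (b τ) G x⟫_ℝ) (Ioo s T) volume ∧
    IntegrableOn (fun τ => ∫ x, ⟪((U s τ y : Lp (EuclideanSpace ℝ d) 2 volume) : UnitAddTorus d → EuclideanSpace ℝ d) x,
        viscAdj 𝔹 G x⟫_ℝ) (Ioo s T) volume ∧
    (∀ᵐ τ ∂(volume.restrict (Ioo s T)),
      (∫ x, ⟪((U s τ y : Lp (EuclideanSpace ℝ d) 2 volume) : UnitAddTorus d → EuclideanSpace ℝ d) x,
          FunctionSpaces.Torus.convect (b τ) G x + viscAdj 𝔹 G x⟫_ℝ) =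
        (∫ x, ⟪((U s τ y : Lp (EuclideanSpace ℝ d) 2 volume) : UnitAddTorus d → EuclideanSpace ℝ d) x,
            FunctionSpaces.Torus.convect (b τ) G x⟫_ℝ) +
          ∫ x, ⟪((U s τ y : Lp (EuclideanSpace ℝ d) 2 volume) : UnitAddTorus d → EuclideanSpace ℝ d) x, viscAdj 𝔹 G x⟫_ℝ) ∧
    ∀ t, s ≤ t → t ≤ T →
      ⟪U s t y, (hG.memLp 2).toLp G⟫_ℝ = ⟪y, (hG.memLp 2).toLp G⟫_ℝ +
        ∫ τ in Ioc s t, ∫ x, ⟪((U s τ y : Lp (EuclideanSpace ℝ d) 2 volume) : UnitAddTorus d → EuclideanSpace ℝ d) x,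
          FunctionSpaces.Torus.convect (b τ) G x + viscAdj 𝔹 G x⟫_ℝ := by
  -- the carrier data on `(0, T)`
  have hsub : Ioo 0 T ×ˢ (univ : Set (EuclideanSpace ℝ d)) ⊆ Ioo 0 T₁ ×ˢ univ :=
    prod_mono (Ioo_subset_Ioo le_rfl hT₁.le) subset_rfl
  have hbT : MemLp (stLift b) ∞ (volume.restrict (Ioo 0 T ×ˢ univ)) := hb.mono_measure (Measure.restrict_mono hsub le_rfl)
  have hbdivT : ∀ᵐ τ ∂(volume.restrict (Ioo 0 T)), FunctionSpaces.Torus.IsWeaklyDivFree (b τ) :=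
    ae_restrict_of_ae_restrict_of_subset (Ioo_subset_Ioo le_rfl hT₁.le) hbdiv
  -- the propagator on the longer horizon restricts to `U` on `[s, T]`
  obtain ⟨U₁, hU₁⟩ := exists_isPropagator (T := T₁) h𝔹 hlo hb hbdiv
  have hU₁T : IsPropagator T b 𝔹 U₁ := hU₁.of_horizon_le h𝔹 hlo hb hbdiv hT₁.le
  have hUU₁ : ∀ τ ∈ Icc s T, U s τ y = U₁ s τ y := fun τ hτ => hU.eq_of_isPropagator hU₁T h𝔹 hlo hbT hbdivT hs hτ.1 hτ.2 y
  obtain ⟨hg, hgC, hgL, hsplit, hid⟩ := hU₁.steadyTest_master_of_lt h𝔹 hlo hb hbdiv hG hGdiv hs (lt_of_le_of_lt hsT hT₁) y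
  -- transfer along `U = U₁` on `(s, T]`
  have hIoo : ∀ τ ∈ Ioo s T, U s τ y = U₁ s τ y := fun τ hτ => hUU₁ τ ⟨hτ.1.le, hτ.2.le⟩
  refine ⟨?_, ?_, ?_, ?_, fun t hst htT => ?_⟩
  · exact (hg.mono_set (Ioo_subset_Ioo le_rfl hT₁.le)).congr_fun (fun τ hτ => by rw [hIoo τ hτ]) measurableSet_Ioo
  · exact (hgC.mono_set (Ioo_subset_Ioo le_rfl hT₁.le)).congr_fun (fun τ hτ => by rw [hIoo τ hτ]) measurableSet_Ioo
  · exact (hgL.mono_set (Ioo_subset_Ioo le_rfl hT₁.le)).congr_fun (fun τ hτ => by rw [hIoo τ hτ]) measurableSet_Ioo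
  · have h1 : ∀ᵐ τ ∂(volume.restrict (Ioo s T)),
        (∫ x, ⟪((U₁ s τ y : Lp (EuclideanSpace ℝ d) 2 volume) : UnitAddTorus d → EuclideanSpace ℝ d) x,
            FunctionSpaces.Torus.convect (b τ) G x + viscAdj 𝔹 G x⟫_ℝ) =
          (∫ x, ⟪((U₁ s τ y : Lp (EuclideanSpace ℝ d) 2 volume) : UnitAddTorus d → EuclideanSpace ℝ d) x,
              FunctionSpaces.Torus.convect (b τ) G x⟫_ℝ) +
            ∫ x, ⟪((U₁ s τ y : Lp (EuclideanSpace ℝ d) 2 volume) : UnitAddTorus d → EuclideanSpace ℝ d) x, viscAdj 𝔹 G x⟫_ℝ :=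
      ae_restrict_of_ae_restrict_of_subset (Ioo_subset_Ioo le_rfl hT₁.le) hsplit
    filter_upwards [h1, ae_restrict_mem measurableSet_Ioo] with τ hτ hτm
    rw [hIoo τ hτm]
    exact hτ
  · rw [hUU₁ t ⟨hst, htT⟩, hid t hst (lt_of_le_of_lt htT hT₁)]
    congr 1
    refine setIntegral_congr_fun measurableSet_Ioc fun τ hτ => ?_
    rw [hUU₁ τ ⟨hτ.1.le, hτ.2.trans htT⟩]

/-- **THE DU BOIS-REYMOND IDENTITY FOR THE PROPAGATOR AGAINST A STEADY SMOOTH SOLENOIDAL TEST** (all admissible times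
`0 ≤ s ≤ t ≤ T`): for `IsPropagator T b 𝔹 U` with `NearIso 𝔹 lo hi`, `0 < lo`, a carrier bounded and a.e. weakly divergence-free on
a longer horizon `(0, T₁)`, `T < T₁`, a smooth divergence-free steady test `G` and every `y ∈ L²`:

  `⟪U s t y, G⟫ = ⟪y, G⟫ + ∫_{τ ∈ (s,t]} ∫_{T^d} ⟪(U s τ y)(x), (b(τ,x)·∇)G(x) + (𝓛_𝔹^*G)(x)⟫ dx dτ`.

(The weak formulation's du Bois-Reymond form on one weak solution represented by `U`; a.e. `t` ⟹ every `t` by continuity of both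
sides; `t = T` through the propagator of horizon `T₁`, which restricts to `U` by uniqueness.)
[cite: DiPernaLions1989, §II.1 (12)–(14)] [cite: Temam1984, Ch. III §1 Lemma 1.2, Lemma 1.4] [cite: Pazy1983, Ch. 5 §5.1 Def. 5.3] -/
theorem IsPropagator.inner_eq_inner_add_setIntegral_of_steadyTest (hU : IsPropagator T b 𝔹 U) (h𝔹 : NearIso 𝔹 lo hi) (hlo : 0 < lo)
    {T₁ : ℝ} (hT₁ : T < T₁) (hb : MemLp (stLift b) ∞ (volume.restrict (Ioo 0 T₁ ×ˢ univ)))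
    (hbdiv : ∀ᵐ τ ∂(volume.restrict (Ioo 0 T₁)), FunctionSpaces.Torus.IsWeaklyDivFree (b τ))
    {G : UnitAddTorus d → EuclideanSpace ℝ d} (hG : FunctionSpaces.Torus.IsSmooth G) (hGdiv : FunctionSpaces.Torus.IsDivFree G)
    {s t : ℝ} (hs : 0 ≤ s) (hst : s ≤ t) (htT : t ≤ T) (y : Lp (EuclideanSpace ℝ d) 2 (volume : Measure (UnitAddTorus d))) :
    ⟪U s t y, (hG.memLp 2).toLp G⟫_ℝ = ⟪y, (hG.memLp 2).toLp G⟫_ℝ +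
      ∫ τ in Ioc s t, ∫ x, ⟪((U s τ y : Lp (EuclideanSpace ℝ d) 2 volume) : UnitAddTorus d → EuclideanSpace ℝ d) x,
        FunctionSpaces.Torus.convect (b τ) G x + viscAdj 𝔹 G x⟫_ℝ :=
  (hU.steadyTest_master h𝔹 hlo hT₁ hb hbdiv hG hGdiv hs (hst.trans htT) y).2.2.2.2 t hst htT

/-- **Integrability of the full generator integrand** `τ ↦ ∫⟪U s τ y, (b(τ)·∇)G + 𝓛_𝔹^*G⟫` on `(s, T)`.
[cite: DiPernaLions1989, §II.1 (12)–(14)] -/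
theorem IsPropagator.integrableOn_inner_generator_steadyTest (hU : IsPropagator T b 𝔹 U) (h𝔹 : NearIso 𝔹 lo hi) (hlo : 0 < lo)
    {T₁ : ℝ} (hT₁ : T < T₁) (hb : MemLp (stLift b) ∞ (volume.restrict (Ioo 0 T₁ ×ˢ univ)))
    (hbdiv : ∀ᵐ τ ∂(volume.restrict (Ioo 0 T₁)), FunctionSpaces.Torus.IsWeaklyDivFree (b τ))
    {G : UnitAddTorus d → EuclideanSpace ℝ d} (hG : FunctionSpaces.Torus.IsSmooth G) (hGdiv : FunctionSpaces.Torus.IsDivFree G)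
    {s : ℝ} (hs : 0 ≤ s) (hsT : s ≤ T) (y : Lp (EuclideanSpace ℝ d) 2 (volume : Measure (UnitAddTorus d))) :
    IntegrableOn (fun τ => ∫ x, ⟪((U s τ y : Lp (EuclideanSpace ℝ d) 2 volume) : UnitAddTorus d → EuclideanSpace ℝ d) x,
        FunctionSpaces.Torus.convect (b τ) G x + viscAdj 𝔹 G x⟫_ℝ) (Ioo s T) volume :=
  (hU.steadyTest_master h𝔹 hlo hT₁ hb hbdiv hG hGdiv hs hsT y).1

/-- **Integrability of the TRANSPORT integrand** `τ ↦ ∫⟪U s τ y, (b(τ)·∇)G⟫` on `(s, T)`. [cite: DiPernaLions1989, §II.1 (12)–(14)] -/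
theorem IsPropagator.integrableOn_inner_convect_steadyTest (hU : IsPropagator T b 𝔹 U) (h𝔹 : NearIso 𝔹 lo hi) (hlo : 0 < lo)
    {T₁ : ℝ} (hT₁ : T < T₁) (hb : MemLp (stLift b) ∞ (volume.restrict (Ioo 0 T₁ ×ˢ univ)))
    (hbdiv : ∀ᵐ τ ∂(volume.restrict (Ioo 0 T₁)), FunctionSpaces.Torus.IsWeaklyDivFree (b τ))
    {G : UnitAddTorus d → EuclideanSpace ℝ d} (hG : FunctionSpaces.Torus.IsSmooth G) (hGdiv : FunctionSpaces.Torus.IsDivFree G)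
    {s : ℝ} (hs : 0 ≤ s) (hsT : s ≤ T) (y : Lp (EuclideanSpace ℝ d) 2 (volume : Measure (UnitAddTorus d))) :
    IntegrableOn (fun τ => ∫ x, ⟪((U s τ y : Lp (EuclideanSpace ℝ d) 2 volume) : UnitAddTorus d → EuclideanSpace ℝ d) x,
        FunctionSpaces.Torus.convect (b τ) G x⟫_ℝ) (Ioo s T) volume :=
  (hU.steadyTest_master h𝔹 hlo hT₁ hb hbdiv hG hGdiv hs hsT y).2.1

/-- **Integrability of the DIFFUSION integrand** `τ ↦ ∫⟪U s τ y, 𝓛_𝔹^*G⟫` on `(s, T)`. [cite: DiPernaLions1989, §II.1 (12)–(14)] -/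
theorem IsPropagator.integrableOn_inner_viscAdj_steadyTest (hU : IsPropagator T b 𝔹 U) (h𝔹 : NearIso 𝔹 lo hi) (hlo : 0 < lo)
    {T₁ : ℝ} (hT₁ : T < T₁) (hb : MemLp (stLift b) ∞ (volume.restrict (Ioo 0 T₁ ×ˢ univ)))
    (hbdiv : ∀ᵐ τ ∂(volume.restrict (Ioo 0 T₁)), FunctionSpaces.Torus.IsWeaklyDivFree (b τ))
    {G : UnitAddTorus d → EuclideanSpace ℝ d} (hG : FunctionSpaces.Torus.IsSmooth G) (hGdiv : FunctionSpaces.Torus.IsDivFree G)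
    {s : ℝ} (hs : 0 ≤ s) (hsT : s ≤ T) (y : Lp (EuclideanSpace ℝ d) 2 (volume : Measure (UnitAddTorus d))) :
    IntegrableOn (fun τ => ∫ x, ⟪((U s τ y : Lp (EuclideanSpace ℝ d) 2 volume) : UnitAddTorus d → EuclideanSpace ℝ d) x,
        viscAdj 𝔹 G x⟫_ℝ) (Ioo s T) volume :=
  (hU.steadyTest_master h𝔹 hlo hT₁ hb hbdiv hG hGdiv hs hsT y).2.2.1

/-- **A.e. splitting of the generator integrand** on `(s, T)`: `∫⟪U s τ y, (b(τ)·∇)G + 𝓛_𝔹^*G⟫ = ∫⟪U s τ y, (b(τ)·∇)G⟫ + ∫⟪U s τ y, 𝓛_𝔹^*G⟫`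
(for a.e. `τ` both spatial integrands are integrable). [cite: DiPernaLions1989, §II.1 (12)–(14)] -/
theorem IsPropagator.ae_inner_generator_eq_add_steadyTest (hU : IsPropagator T b 𝔹 U) (h𝔹 : NearIso 𝔹 lo hi) (hlo : 0 < lo)
    {T₁ : ℝ} (hT₁ : T < T₁) (hb : MemLp (stLift b) ∞ (volume.restrict (Ioo 0 T₁ ×ˢ univ)))
    (hbdiv : ∀ᵐ τ ∂(volume.restrict (Ioo 0 T₁)), FunctionSpaces.Torus.IsWeaklyDivFree (b τ))
    {G : UnitAddTorus d → EuclideanSpace ℝ d} (hG : FunctionSpaces.Torus.IsSmooth G) (hGdiv : FunctionSpaces.Torus.IsDivFree G)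
    {s : ℝ} (hs : 0 ≤ s) (hsT : s ≤ T) (y : Lp (EuclideanSpace ℝ d) 2 (volume : Measure (UnitAddTorus d))) :
    ∀ᵐ τ ∂(volume.restrict (Ioo s T)),
      (∫ x, ⟪((U s τ y : Lp (EuclideanSpace ℝ d) 2 volume) : UnitAddTorus d → EuclideanSpace ℝ d) x,
          FunctionSpaces.Torus.convect (b τ) G x + viscAdj 𝔹 G x⟫_ℝ) =
        (∫ x, ⟪((U s τ y : Lp (EuclideanSpace ℝ d) 2 volume) : UnitAddTorus d → EuclideanSpace ℝ d) x,
            FunctionSpaces.Torus.convect (b τ) G x⟫_ℝ) +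
          ∫ x, ⟪((U s τ y : Lp (EuclideanSpace ℝ d) 2 volume) : UnitAddTorus d → EuclideanSpace ℝ d) x, viscAdj 𝔹 G x⟫_ℝ :=
  (hU.steadyTest_master h𝔹 hlo hT₁ hb hbdiv hG hGdiv hs hsT y).2.2.2.1

/-- **THE IDENTITY WITH THE TWO INTEGRANDS SEPARATED** (transport and diffusion), all admissible times `0 ≤ s ≤ t ≤ T`:

  `⟪U s t y, G⟫ = ⟪y, G⟫ + ∫_{(s,t]} ∫⟪U s τ y, (b(τ)·∇)G⟫ dτ + ∫_{(s,t]} ∫⟪U s τ y, 𝓛_𝔹^*G⟫ dτ`.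

[cite: DiPernaLions1989, §II.1 (12)–(14)] [cite: Temam1984, Ch. III §1 Lemma 1.2, Lemma 1.4] -/
theorem IsPropagator.inner_eq_inner_add_setIntegral_add_setIntegral_of_steadyTest (hU : IsPropagator T b 𝔹 U)
    (h𝔹 : NearIso 𝔹 lo hi) (hlo : 0 < lo) {T₁ : ℝ} (hT₁ : T < T₁) (hb : MemLp (stLift b) ∞ (volume.restrict (Ioo 0 T₁ ×ˢ univ)))
    (hbdiv : ∀ᵐ τ ∂(volume.restrict (Ioo 0 T₁)), FunctionSpaces.Torus.IsWeaklyDivFree (b τ))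
    {G : UnitAddTorus d → EuclideanSpace ℝ d} (hG : FunctionSpaces.Torus.IsSmooth G) (hGdiv : FunctionSpaces.Torus.IsDivFree G)
    {s t : ℝ} (hs : 0 ≤ s) (hst : s ≤ t) (htT : t ≤ T) (y : Lp (EuclideanSpace ℝ d) 2 (volume : Measure (UnitAddTorus d))) :
    ⟪U s t y, (hG.memLp 2).toLp G⟫_ℝ = ⟪y, (hG.memLp 2).toLp G⟫_ℝ +
      (∫ τ in Ioc s t, ∫ x, ⟪((U s τ y : Lp (EuclideanSpace ℝ d) 2 volume) : UnitAddTorus d → EuclideanSpace ℝ d) x,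
        FunctionSpaces.Torus.convect (b τ) G x⟫_ℝ) +
      ∫ τ in Ioc s t, ∫ x, ⟪((U s τ y : Lp (EuclideanSpace ℝ d) 2 volume) : UnitAddTorus d → EuclideanSpace ℝ d) x,
        viscAdj 𝔹 G x⟫_ℝ := by
  obtain ⟨-, hgC, hgL, hsplit, hid⟩ := hU.steadyTest_master h𝔹 hlo hT₁ hb hbdiv hG hGdiv hs (hst.trans htT) y
  rw [hid t hst htT, add_assoc]
  congr 1
  -- `(s, t] ⊆ (s, T)` up to the null set `{T}`
  have hsub : ∀ᵐ τ ∂(volume.restrict (Ioc s t)),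
      (∫ x, ⟪((U s τ y : Lp (EuclideanSpace ℝ d) 2 volume) : UnitAddTorus d → EuclideanSpace ℝ d) x,
          FunctionSpaces.Torus.convect (b τ) G x + viscAdj 𝔹 G x⟫_ℝ) =
        (∫ x, ⟪((U s τ y : Lp (EuclideanSpace ℝ d) 2 volume) : UnitAddTorus d → EuclideanSpace ℝ d) x,
            FunctionSpaces.Torus.convect (b τ) G x⟫_ℝ) +
          ∫ x, ⟪((U s τ y : Lp (EuclideanSpace ℝ d) 2 volume) : UnitAddTorus d → EuclideanSpace ℝ d) x, viscAdj 𝔹 G x⟫_ℝ := by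
    rw [← Measure.restrict_congr_set Ioo_ae_eq_Ioc]
    exact ae_restrict_of_ae_restrict_of_subset (Ioo_subset_Ioo le_rfl htT) hsplit
  have hC : IntegrableOn (fun τ => ∫ x, ⟪((U s τ y : Lp (EuclideanSpace ℝ d) 2 volume) : UnitAddTorus d → EuclideanSpace ℝ d) x,
      FunctionSpaces.Torus.convect (b τ) G x⟫_ℝ) (Ioc s t) volume := by
    rw [integrableOn_Ioc_iff_integrableOn_Ioo]
    exact hgC.mono_set (Ioo_subset_Ioo le_rfl htT)
  have hL : IntegrableOn (fun τ => ∫ x, ⟪((U s τ y : Lp (EuclideanSpace ℝ d) 2 volume) : UnitAddTorus d → EuclideanSpace ℝ d) x,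
      viscAdj 𝔹 G x⟫_ℝ) (Ioc s t) volume := by
    rw [integrableOn_Ioc_iff_integrableOn_Ioo]
    exact hgL.mono_set (Ioo_subset_Ioo le_rfl htT)
  rw [integral_congr_ae hsub, integral_add hC hL]

end Torus

end Literature.Analysis.FluidPDE

end
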